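import Summits.QuantumFields.YangMills.Theorems.UnitScaleTiltProp7MassiveSolutionGradientSup
import Summits.QuantumFields.YangMills.Theorems.UnitScaleTiltProp7MassiveSolutionPointwiseDecay
import HarnessLib

/-!
# Route `UnitScaleTilt`, crux K1 (stmt-QuantumFields-19200), EX row `hPcol` — (L3′b) brick **T1 CLOSED: `‖D_{U₀}(G_a f)‖_∞ ≤ R₁·‖f‖_∞` ON A GENERAL BOUNDED SOURCE, K-free at the pins**
# (px5 g12 LOCATE-hPcol v2 42098c54 §2 «T1, THE ONE MISSING BRICK»; `D R_S G′ᴾ g = D G_a f`) = px19 g13's T1-core ✓`Prop7MassiveSolutionGradientSup.norm_equiv_DL2_le_of_sup` (sup → sup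
# gradient row for ANY `(u, q)` with `Δ^η_{U₀}u + q = 0`) ∘ the two VALUE letters it displays, PROVED HERE for a general bounded source (row sums of ★p1∕px5's V4g
# ✓`Prop7MassiveSolutionPointwiseDecay` over the block decomposition of `f`).  Cell `ym3-torus` (rung R3 = SU(2) YM₃ on T³ — NOT d = 4, NOT infinite volume, NOT a mass gap,
# NOT Clay); width seat `ym3-torus-px12` (gen 16); px19∕px12 cut of T1 (bus 07:21Z–07:26Z).  THEOREMS ONLY (0 `def`, 0 `sorry`, default heartbeats); `--supports stmt-QuantumFields-19200`.

WHY.  V2 ✓`norm_equiv_massive_solution_le` carries the support letter `√(c₀·#S)` and V2's penalty letter carries `‖u‖_{L²}` — K-free only for ONE-BLOCK sources; the `hPcol` knit (px5 g13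
`…PcolOfGradientRow`, letters `hGsup`∕`hT1`) needs `G_a` on a GENERAL bounded site source.  Cure (print's): `f = Σ_v f·𝟙_{B(v)}` over the coarse blocks (§1); V4g's one-block POINTWISE
DECAY rows ★★★`norm_equiv_massiveSolution_apply_le_decay` ∕ `norm_equiv_penalty_solution_le` per piece (its `L²` size is `≤ √(c₀(L^d)^{K−n})·‖f‖_∞`, K-free at the pin `c₁ = c₀ℓ³`);
the coarse sum px12 ✓`sum_exp_neg_mul_tdist_coarse_le` (`Σ_v e^{−ν·dc} ≤ (2(1+1∕ν))³`) — §2–§3; then T1-core at `u := G_a f`, `q := a•T(ι(Q″(G_a f))) − f` (§5) and the `F_b`-factored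
letter shapes (§6).  Print: [Balaban1985BackgroundPropagators] Thm 3.1 (3.42)–(3.44) read as `ℓ^∞ → ℓ^∞` bounds for `G` and `∇^η_{U₀}G` ((3.45)–(3.47)), for the operators of (3.139).

WHAT IS PROVED (ns `…Theorems.Prop7MassiveSolutionGradientSupOfRegPr`; V4g's letters VERBATIM: `h hε₀ hε7 U₀ hreg Q″ hseq ι hι T hT ha G hAG hμ hδ₁ hδ hwin`).
* §1 `sum_blockCut_eq`, `blockCut_apply_eq_zero`, `norm_equiv_blockCut_le`, ★`norm_blockCut_le` (`‖f_v‖ ≤ √(c₀(L^d)^{K−n})·‖f‖_∞`, ✓`card_iterBlock`).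
* §2 ★★★ `norm_equiv_massiveSolution_apply_le_of_sup` — `‖(G_a f)(x₀)‖ ≤ (A₁ + A₂)(‖f‖_∞)·(2(1 + 2∕κ₀))³`, `κ₀ = min μ ¼`, `A₁, A₂` = V4g's two coefficients at the block-cut size.
* §3 ★★ `norm_equiv_penalty_solution_le_of_sup` — `‖(a•T(ι(Q″(G_a f))))(x₀)‖ ≤ P·e^{3μ}·(8√M)²·√(c₀(L^d)^{K−n})·‖f‖_∞·(2(1 + 1∕μ))³`.
* §5 ★★★ `norm_equiv_DL2_massiveSolution_le` — **T1 CLOSED**: `∀ p, ‖(D_{U₀}(G_a f))(p)‖ ≤ 2·(C_g·(M_u(F_b)·c(ε₀) + (M_p(F_b) + F_b)) + 2√2·48ε₀·M_u(F_b))`, `M_u`, `M_p` = §2∕§3's bounds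
  (T1-core at `(G f, a•TιQ″(G f) − f)`) — hypotheses = V4g's letters + `hroom` + `hsmall` ONLY.
* §6 ★★★ `hGsup_of_regPr` · ★★★ `hT1_of_regPr` — §2∕§5 with `F_b` FACTORED (`ring`): the knit's two general-source letters in its VERBATIM shape `∀ f Fb, (∀ y, ‖f y‖ ≤ Fb) → ∀ ·, ‖…‖ ≤ C·Fb`.
HYP-SAT (★★OWNER RULING №42).  `RegPr`, the LOD letters (⟸ ✓`exists_intertwiner_of_regPr`, ✓`exists_massive_inverse`), V4's Agmon window (⟸ routeR-w4 ✓`window_delta`∕`window_win` at the pin),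
`hroom` (CHAIR WORD №1 class; a sup row descends along ✓`CoverSites` for small members), `hsmall` (ε₀ vs the universal `C_g`); `hFb` = the sup of the displayed source.  Conclusions are
non-vacuous; no `Prop` hypothesis restates them.  HONEST SCOPE: composition of landed rows; nothing of `hPcol` (the P4 knit), the ten EX rows, EX or the crux is proved here; YM gap NOT proved.

References: T. Bałaban, CMP **99** (1985) 389–434 [Balaban1985BackgroundPropagators] ((3.24) p.394, Thm 3.1 (3.42)–(3.47) pp.397–398, (3.49) p.399, (3.139) p.425);
CMP **95** (1984) 17–40 [Balaban1984PropagatorsI] ((1.18) p.20 — the blocks `B^k(y)`).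
-/


set_option autoImplicit false

noncomputable section

open scoped BigOperators Matrix.Norms.L2Operator InnerProductSpace ComplexConjugate

namespace Summit.QuantumFields.YangMills.Theorems.Prop7MassiveSolutionGradientSupOfRegPr

open Literature.MathematicalPhysics.QuantumFieldTheory.Balaban1983to89
open Literature.MathematicalPhysics.QuantumFieldTheory.Balaban1983to89.T3ContinuumYM3Torus
open T4Continuum BlockAveraging
open BlockAveraging (Idx)
open B7Prop1Explicit (disp)
open B5Eq118OneStroke (iterBlockOf iterBlock mem_iterBlock card_iterBlock)
open B10Eq27TorusAxialLog (holT transl)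
open B7TransferAnalyticMean (meanCLM)
open B4Sect5Torus (TSite)
open B9Eq311L2Pairing (WL2)
open B11Eq103H1Complex (SiteL2K)
open Summit.QuantumFields.YangMills.Theorems.Prop8Chart (emlIterU)
open T3SectALandauChart (eta bgUnits)
open T3PrintedRegularMinimiser (RegPr)
open T3PrintedRegularOrbits (sites_eq)
open T3LevelShift (siteShift)
open Summit.QuantumFields.YangMills.Theorems.Prop7SectET3Transport (periodsT3 siteEquiv)
open Summit.QuantumFields.YangMills.Theorems.Prop7SectET3HilbertLetters (W₂ frobEquiv toL2S covLapSite toL2S_apply toL2S_symm_apply frobEquiv_symm_apply_apply)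
open Summit.QuantumFields.YangMills.Theorems.Prop7LaplaceAFlatLetters (norm_sq_toL2S)
open Summit.QuantumFields.YangMills.Theorems.Prop7BlockDistanceWeights (sum_exp_neg_mul_tdist_coarse_le tdist_coarse_comm)
open Summit.QuantumFields.YangMills.Theorems.Prop7MassiveColumnPointwiseDecay (normSq_equiv_eq)
open Summit.QuantumFields.YangMills.Theorems.Prop7MassiveSolutionPointwiseDecay (norm_equiv_massiveSolution_apply_le_decay norm_equiv_penalty_solution_le)
open Summit.QuantumFields.YangMills.Theorems.Prop7SectET3HilbertLetters (DL2 DstarL2)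
open B9SectCLatticeCarrier (Bond)
open Summit.QuantumFields.YangMills.Theorems.Prop7CurvedMemberLocalGradient (exists_curved_localGradient)
open Summit.QuantumFields.YangMills.Theorems.AxialGaugeChartGlue (norm_bgOfCfg_axialT_sub_le)
open Summit.QuantumFields.YangMills.Theorems.Prop7MassiveSolutionGradientSup (norm_equiv_DL2_le_of_sup)

variable (F : T3Family) {n K : ℕ} (h : n ≤ K) {c₀ c₁ : ℝ} [Fact (0 < c₀)] [Fact (0 < c₁)]
  {ε₀ : ℝ} (hε₀ : 0 < ε₀) (hε7 : 10 ^ 7 * (F.L : ℝ) ^ 3 * ε₀ ≤ 1)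
  (U₀ : GaugeField (F.P K) 0 (Matrix.specialUnitaryGroup (Fin 2) ℂ)) (hreg : RegPr F n K ε₀ U₀)
  (Q'' : SiteL2K ℂ 3 (periodsT3 F K) c₀ W₂ →ₗ[ℂ] (Site (F.P K) (K - n) → Matrix (Fin 2) (Fin 2) ℂ))
  (hseq : ∀ lam : Site (F.P K) 0 → Matrix (Fin 2) (Fin 2) ℂ, ∃ ns : (j : ℕ) → Site (F.P K) j → Matrix (Fin 2) (Fin 2) ℂ, ns 0 = lam ∧
      (∀ (j : ℕ) (y : Site (F.P K) (j + 1)), ns (j + 1) y = ns j (emb y) - meanCLM (Idx (F.P K)) (Matrix (Fin 2) (Fin 2) ℂ) fun i : Idx (F.P K) =>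
        ns j (emb y) - ((holT (emlIterU j (bgUnits F K U₀)) (emb y) (stairWord i.2.1 (off i.1)) : (Matrix (Fin 2) (Fin 2) ℂ)ˣ) : Matrix (Fin 2) (Fin 2) ℂ) *
          ns j (transl (emb y) (disp (stairWord i.2.1 (off i.1)))) * (((holT (emlIterU j (bgUnits F K U₀)) (emb y) (stairWord i.2.1 (off i.1)))⁻¹ : (Matrix (Fin 2) (Fin 2) ℂ)ˣ) : Matrix (Fin 2) (Fin 2) ℂ)) ∧
      ns (K - n) = Q'' (toL2S F K c₀ lam))
  (ι : (Site (F.P K) (K - n) → Matrix (Fin 2) (Fin 2) ℂ) →ₗ[ℂ] SiteL2K ℂ 3 (periodsT3 F n) c₁ W₂)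
  (hι : ∀ c, ι c = toL2S F n c₁ (fun z => c (siteShift (sites_eq F n K h) z)))
  (T : SiteL2K ℂ 3 (periodsT3 F n) c₁ W₂ →ₗ[ℂ] SiteL2K ℂ 3 (periodsT3 F K) c₀ W₂)
  (hT : ∀ (l : SiteL2K ℂ 3 (periodsT3 F K) c₀ W₂) (f : SiteL2K ℂ 3 (periodsT3 F n) c₁ W₂), ⟪ι (Q'' l), f⟫_ℂ = ⟪l, T f⟫_ℂ)
  {a : ℝ} (ha : 0 < a)
/-! ## §1 The block decomposition of a bounded source -/

omit [Fact (0 < c₀)] [Fact (0 < c₁)] in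
/-- **BLOCK DECOMPOSITION**: `f = Σ_v toL2S(𝟙_{B(v)}·toL2S⁻¹ f)` over the coarse sites `v`. [folklore] -/
theorem sum_blockCut_eq (f : SiteL2K ℂ 3 (periodsT3 F K) c₀ W₂) :
    ∑ v : Site (F.P K) (K - n), toL2S F K c₀ (fun x => if iterBlockOf (K - n) x = v then (toL2S F K c₀).symm f x else 0) = f := by
  classical
  have hpt : (∑ v : Site (F.P K) (K - n), fun x => if iterBlockOf (K - n) x = v then (toL2S F K c₀).symm f x else 0)
      = (toL2S F K c₀).symm f := by
    funext x
    rw [Finset.sum_apply, Finset.sum_ite_eq, if_pos (Finset.mem_univ _)]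
  rw [← map_sum, hpt, LinearEquiv.apply_symm_apply]

omit [Fact (0 < c₀)] [Fact (0 < c₁)] in
/-- A block cut is supported on its block. [folklore] -/
theorem blockCut_apply_eq_zero (f : SiteL2K ℂ 3 (periodsT3 F K) c₀ W₂) (v : Site (F.P K) (K - n)) :
    ∀ x, iterBlockOf (K - n) x ≠ v →
      (toL2S F K c₀).symm (toL2S F K c₀ (fun x => if iterBlockOf (K - n) x = v then (toL2S F K c₀).symm f x else 0)) x = 0 := by
  intro x hx
  rw [LinearEquiv.symm_apply_apply, if_neg hx]

omit [Fact (0 < c₀)] [Fact (0 < c₁)] in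
/-- A block cut is pointwise bounded by the source's sup. [folklore] -/
theorem norm_equiv_blockCut_le (f : SiteL2K ℂ 3 (periodsT3 F K) c₀ W₂) {Fb : ℝ}
    (hFb : ∀ x : Site (F.P K) 0, ‖WL2.equiv ℂ _ W₂ f (siteEquiv F K x)‖ ≤ Fb) (v : Site (F.P K) (K - n)) :
    ∀ x : Site (F.P K) 0, ‖WL2.equiv ℂ _ W₂ (toL2S F K c₀ (fun x => if iterBlockOf (K - n) x = v then (toL2S F K c₀).symm f x else 0)) (siteEquiv F K x)‖ ≤ Fb := by
  intro x
  have hFb0 : 0 ≤ Fb := (norm_nonneg _).trans (hFb x)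
  rw [toL2S_apply, Equiv.symm_apply_apply]
  by_cases hx : iterBlockOf (K - n) x = v
  · rw [if_pos hx, toL2S_symm_apply, LinearEquiv.symm_apply_apply]
    exact hFb x
  · rw [if_neg hx, map_zero, norm_zero]
    exact hFb0

omit [Fact (0 < c₁)] in
/-- **THE `L²` SIZE OF ONE BLOCK CUT**: `‖toL2S(𝟙_{B(v)}·toL2S⁻¹ f)‖ ≤ √(c₀·(L^d)^{K−n})·‖f‖_∞` — `(L^d)^{K−n}` fine sites per block (✓`card_iterBlock`), each carrying at most `‖f‖_∞`.
[cite: Balaban1984PropagatorsI, (1.18) p.20] -/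
theorem norm_blockCut_le (f : SiteL2K ℂ 3 (periodsT3 F K) c₀ W₂) {Fb : ℝ}
    (hFb : ∀ x : Site (F.P K) 0, ‖WL2.equiv ℂ _ W₂ f (siteEquiv F K x)‖ ≤ Fb) (v : Site (F.P K) (K - n)) :
    ‖toL2S F K c₀ (fun x => if iterBlockOf (K - n) x = v then (toL2S F K c₀).symm f x else 0)‖
      ≤ Real.sqrt (c₀ * ((((F.P K).L : ℝ) ^ (F.P K).d) ^ (K - n))) * Fb := by
  classical
  have hc₀ : 0 < c₀ := Fact.out
  have hFb0 : 0 ≤ Fb := (norm_nonneg _).trans (hFb (fun _ => 0))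
  have hX : 0 ≤ (((F.P K).L : ℝ) ^ (F.P K).d) ^ (K - n) := by positivity
  -- the fine sites of the block
  have hk : K - n ≤ (F.P K).m + (F.P K).K := by
    show K - n ≤ F.m + K
    omega
  have hcard : ((Finset.univ.filter fun x : Site (F.P K) 0 => iterBlockOf (K - n) x = v).card : ℝ) = (((F.P K).L : ℝ) ^ (F.P K).d) ^ (K - n) := by
    have : (Finset.univ.filter fun x : Site (F.P K) 0 => iterBlockOf (K - n) x = v) = iterBlock (K - n) v := by
      ext x; simp [mem_iterBlock]
    rw [this, card_iterBlock (K - n) hk v]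
    push_cast
    ring
  -- termwise
  have hterm : ∀ x : Site (F.P K) 0,
      (∑ i : Fin 2, ∑ i' : Fin 2, ‖(if iterBlockOf (K - n) x = v then (toL2S F K c₀).symm f x else 0) i i'‖ ^ 2)
        ≤ if iterBlockOf (K - n) x = v then Fb ^ 2 else 0 := by
    intro x
    by_cases hx : iterBlockOf (K - n) x = v
    · rw [if_pos hx, if_pos hx, ← normSq_equiv_eq]
      exact pow_le_pow_left₀ (norm_nonneg _) (hFb x) 2
    · rw [if_neg hx, if_neg hx]
      simp
  have hsq : ‖toL2S F K c₀ (fun x => if iterBlockOf (K - n) x = v then (toL2S F K c₀).symm f x else 0)‖ ^ 2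
      ≤ (Real.sqrt (c₀ * ((((F.P K).L : ℝ) ^ (F.P K).d) ^ (K - n))) * Fb) ^ 2 := by
    rw [norm_sq_toL2S, mul_pow, Real.sq_sqrt (by positivity)]
    calc c₀ * ∑ x : Site (F.P K) 0, ∑ i : Fin 2, ∑ i' : Fin 2, ‖(if iterBlockOf (K - n) x = v then (toL2S F K c₀).symm f x else 0) i i'‖ ^ 2
        ≤ c₀ * ∑ x : Site (F.P K) 0, (if iterBlockOf (K - n) x = v then Fb ^ 2 else 0) :=
          mul_le_mul_of_nonneg_left (Finset.sum_le_sum fun x _ => hterm x) hc₀.le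
      _ = c₀ * (((F.P K).L : ℝ) ^ (F.P K).d) ^ (K - n) * Fb ^ 2 := by
          rw [Finset.sum_ite, Finset.sum_const_zero, add_zero, Finset.sum_const, nsmul_eq_mul, hcard]
          ring
  exact (pow_le_pow_iff_left₀ (norm_nonneg _) (by positivity) two_ne_zero).mp hsq
/-! ## §2–§3 The VALUE letters of `G_a` on a general bounded source (row sums of V4g) -/

include hε₀ hε7 hreg hseq hι hT ha in
/-- ★★★ **`‖(G_a f)(x₀)‖ ≤ B_∞·‖f‖_∞` FOR EVERY BOUNDED SOURCE** ([Balaban1985BackgroundPropagators] Thm 3.1 (3.42), value entry, read as an `ℓ^∞ → ℓ^∞` bound): the block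
decomposition `f = Σ_v f_v`, linearity of `G`, V4g ✓`norm_equiv_massiveSolution_apply_le_decay` per block (`‖f_v‖_{L²} ≤ √(c₀(L^d)^{K−n})·‖f‖_∞`, ✓`norm_blockCut_le`;
`e^{−κ₀d} ≤ e^{−(κ₀∕2)d}`), and the coarse sum ✓`sum_exp_neg_mul_tdist_coarse_le` (`Σ_v e^{−(κ₀∕2)·tdist(B x₀, v)} ≤ (2(1 + 2∕κ₀))³`), `κ₀ = min μ ¼`.
[cite: Balaban1985BackgroundPropagators, Thm 3.1 (3.42) p.397, (3.45)–(3.46) p.398] -/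
theorem norm_equiv_massiveSolution_apply_le_of_sup
    (G : SiteL2K ℂ 3 (periodsT3 F K) c₀ W₂ →ₗ[ℂ] SiteL2K ℂ 3 (periodsT3 F K) c₀ W₂)
    (hAG : ∀ f, covLapSite F n K c₀ U₀ (G f) + (a : ℂ) • T (ι (Q'' (G f))) = f)
    {μ : ℝ} (hμ : 0 < μ) {δ₁ : ℝ} (hδ₁ : 0 ≤ δ₁)
    (hδ : 3 * ((eta F n K)⁻¹) ^ 2 * (Real.exp (μ * eta F n K) - 1) ^ 2 + a * ((25 / 8) * (c₁ * ((((F.P K).L : ℝ) ^ (F.P K).d) ^ (K - n))⁻¹ / c₀)) * (Real.exp (3 * μ) - 1) ^ 2 ≤ δ₁ ^ 2)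
    (hwin : Real.sqrt (max 2 (16 * c₀ * ((F.L : ℝ) ^ (K - n)) ^ 3 / (a * c₁))) * δ₁ ≤ 1 / 10)
    (f : SiteL2K ℂ 3 (periodsT3 F K) c₀ W₂) {Fb : ℝ} (hFb : ∀ x : Site (F.P K) 0, ‖WL2.equiv ℂ _ W₂ f (siteEquiv F K x)‖ ≤ Fb) (x₀ : Site (F.P K) 0) :
    ‖WL2.equiv ℂ _ W₂ (G f) (siteEquiv F K x₀)‖
      ≤ ((14 * (8 * Real.exp (3 * min μ (1 / 4)) * (Fb + Real.exp (3 * μ) * ((a * ((5 / 4) * Real.sqrt (2 * c₁) * ((((F.P K).L : ℝ) ^ (F.P K).d) ^ (K - n))⁻¹ / c₀) * Real.sqrt ((25 / 8) * (c₁ * ((((F.P K).L : ℝ) ^ (F.P K).d) ^ (K - n))⁻¹ / c₀))) * ((8 * Real.sqrt (max 2 (16 * c₀ * ((F.L : ℝ) ^ (K - n)) ^ 3 / (a * c₁))) ^ 2) * (Real.sqrt (c₀ * ((((F.P K).L : ℝ) ^ (F.P K).d) ^ (K - n))) * Fb))))))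
          + (Real.sqrt (3 ^ 3 / (c₀ * ((F.L : ℝ) ^ (K - n)) ^ 3) * 8) * (Real.sqrt (8 * Real.exp (3 * min μ (1 / 4)) * Real.exp (6 * μ) * (2 * (1 + 1 / μ)) ^ 3) * ((8 * Real.sqrt (max 2 (16 * c₀ * ((F.L : ℝ) ^ (K - n)) ^ 3 / (a * c₁))) ^ 2) * (Real.sqrt (c₀ * ((((F.P K).L : ℝ) ^ (F.P K).d) ^ (K - n))) * Fb)))))
        * (2 * (1 + 1 / (min μ (1 / 4) / 2))) ^ 3 := by
  classical
  have hc₀ : 0 < c₀ := Fact.out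
  have hc₁ : 0 < c₁ := Fact.out
  have hFb0 : 0 ≤ Fb := (norm_nonneg _).trans (hFb x₀)
  have hκ0 : 0 < min μ (1 / 4) := lt_min hμ (by norm_num)
  have hκ2 : 0 < min μ (1 / 4) / 2 := by positivity
  set S : ℝ := Real.sqrt (c₀ * ((((F.P K).L : ℝ) ^ (F.P K).d) ^ (K - n))) * Fb with hS
  set A₁ : ℝ := (14 * (8 * Real.exp (3 * min μ (1 / 4)) * (Fb + Real.exp (3 * μ) * ((a * ((5 / 4) * Real.sqrt (2 * c₁) * ((((F.P K).L : ℝ) ^ (F.P K).d) ^ (K - n))⁻¹ / c₀) * Real.sqrt ((25 / 8) * (c₁ * ((((F.P K).L : ℝ) ^ (F.P K).d) ^ (K - n))⁻¹ / c₀))) * ((8 * Real.sqrt (max 2 (16 * c₀ * ((F.L : ℝ) ^ (K - n)) ^ 3 / (a * c₁))) ^ 2) * S))))) with hA₁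
  set A₂ : ℝ := (Real.sqrt (3 ^ 3 / (c₀ * ((F.L : ℝ) ^ (K - n)) ^ 3) * 8) * (Real.sqrt (8 * Real.exp (3 * min μ (1 / 4)) * Real.exp (6 * μ) * (2 * (1 + 1 / μ)) ^ 3) * ((8 * Real.sqrt (max 2 (16 * c₀ * ((F.L : ℝ) ^ (K - n)) ^ 3 / (a * c₁))) ^ 2) * S))) with hA₂
  have hA₁0 : 0 ≤ A₁ := by positivity
  have hA₂0 : 0 ≤ A₂ := by positivity
  set g : Site (F.P K) (K - n) → SiteL2K ℂ 3 (periodsT3 F K) c₀ W₂ :=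
    fun v => toL2S F K c₀ (fun x => if iterBlockOf (K - n) x = v then (toL2S F K c₀).symm f x else 0) with hg
  have hsum : ∑ v, g v = f := sum_blockCut_eq F f
  have hGsum : WL2.equiv ℂ _ W₂ (G f) (siteEquiv F K x₀) = ∑ v, WL2.equiv ℂ _ W₂ (G (g v)) (siteEquiv F K x₀) := by
    have e := congrFun (map_sum (WL2.linearEquiv ℂ ℂ (fun _ : TSite 3 (periodsT3 F K) => c₀) (V := W₂)) (fun v => G (g v)) Finset.univ) (siteEquiv F K x₀)
    simp only [WL2.linearEquiv_apply, Finset.sum_apply] at e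
    rw [← e, ← map_sum, hsum]
  -- each block's contribution (V4g), with the block-cut size and the slower rate
  have hterm : ∀ v, ‖WL2.equiv ℂ _ W₂ (G (g v)) (siteEquiv F K x₀)‖
      ≤ (A₁ + A₂) * Real.exp (-(min μ (1 / 4) / 2 * (Site.tdist (iterBlockOf (K - n) x₀) v : ℝ))) := by
    intro v
    have hV := norm_equiv_massiveSolution_apply_le_decay F h hε₀ hε7 U₀ hreg Q'' hseq ι hι T hT ha G hAG hμ hδ₁ hδ hwin (g v) v
      (blockCut_apply_eq_zero F f v) (norm_equiv_blockCut_le F f hFb v) x₀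
    have hnv : ‖g v‖ ≤ S := norm_blockCut_le F f hFb v
    have he1 : Real.exp (-(min μ (1 / 4) * (Site.tdist (iterBlockOf (K - n) x₀) v : ℝ)))
        ≤ Real.exp (-(min μ (1 / 4) / 2 * (Site.tdist (iterBlockOf (K - n) x₀) v : ℝ))) :=
      Real.exp_le_exp.mpr (by nlinarith [hκ0.le])
    have h1 : (14 * (8 * Real.exp (3 * min μ (1 / 4)) * (Fb + Real.exp (3 * μ) * ((a * ((5 / 4) * Real.sqrt (2 * c₁) * ((((F.P K).L : ℝ) ^ (F.P K).d) ^ (K - n))⁻¹ / c₀) * Real.sqrt ((25 / 8) * (c₁ * ((((F.P K).L : ℝ) ^ (F.P K).d) ^ (K - n))⁻¹ / c₀))) * ((8 * Real.sqrt (max 2 (16 * c₀ * ((F.L : ℝ) ^ (K - n)) ^ 3 / (a * c₁))) ^ 2) * ‖g v‖))))) ≤ A₁ := by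
      rw [hA₁]; gcongr
    have h2 : (Real.sqrt (3 ^ 3 / (c₀ * ((F.L : ℝ) ^ (K - n)) ^ 3) * 8) * (Real.sqrt (8 * Real.exp (3 * min μ (1 / 4)) * Real.exp (6 * μ) * (2 * (1 + 1 / μ)) ^ 3) * ((8 * Real.sqrt (max 2 (16 * c₀ * ((F.L : ℝ) ^ (K - n)) ^ 3 / (a * c₁))) ^ 2) * ‖g v‖))) ≤ A₂ := by
      rw [hA₂]; gcongr
    calc _ ≤ _ := hV
      _ ≤ A₁ * Real.exp (-(min μ (1 / 4) / 2 * (Site.tdist (iterBlockOf (K - n) x₀) v : ℝ)))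
          + A₂ * Real.exp (-(min μ (1 / 4) / 2 * (Site.tdist (iterBlockOf (K - n) x₀) v : ℝ))) :=
          add_le_add (mul_le_mul h1 he1 (Real.exp_pos _).le hA₁0) (mul_le_mul_of_nonneg_right h2 (Real.exp_pos _).le)
      _ = _ := by ring
  -- the coarse sum (symmetrise the block distance to the shape of ✓`sum_exp_neg_mul_tdist_coarse_le`)
  have hrow : ∑ v : Site (F.P K) (K - n), Real.exp (-(min μ (1 / 4) / 2 * (Site.tdist (iterBlockOf (K - n) x₀) v : ℝ)))
      ≤ (2 * (1 + 1 / (min μ (1 / 4) / 2))) ^ 3 := by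
    have h' := sum_exp_neg_mul_tdist_coarse_le F (n := n) (K := K) hκ2 (iterBlockOf (K - n) x₀)
    refine le_of_eq_of_le (Finset.sum_congr rfl fun v _ => ?_) h'
    rw [tdist_coarse_comm F (iterBlockOf (K - n) x₀) v]
  calc ‖WL2.equiv ℂ _ W₂ (G f) (siteEquiv F K x₀)‖
      = ‖∑ v, WL2.equiv ℂ _ W₂ (G (g v)) (siteEquiv F K x₀)‖ := by rw [hGsum]
    _ ≤ ∑ v, ‖WL2.equiv ℂ _ W₂ (G (g v)) (siteEquiv F K x₀)‖ := norm_sum_le _ _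
    _ ≤ ∑ v, (A₁ + A₂) * Real.exp (-(min μ (1 / 4) / 2 * (Site.tdist (iterBlockOf (K - n) x₀) v : ℝ))) := Finset.sum_le_sum fun v _ => hterm v
    _ = (A₁ + A₂) * ∑ v, Real.exp (-(min μ (1 / 4) / 2 * (Site.tdist (iterBlockOf (K - n) x₀) v : ℝ))) := by rw [Finset.mul_sum]
    _ ≤ (A₁ + A₂) * (2 * (1 + 1 / (min μ (1 / 4) / 2))) ^ 3 := mul_le_mul_of_nonneg_left hrow (add_nonneg hA₁0 hA₂0)

include hε₀ hε7 hreg hseq hι hT ha in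
/-- ★★ **THE PENALTY SUP ON A GENERAL BOUNDED SOURCE**: `‖(a•T(ι(Q″(G_a f))))(x₀)‖ ≤ p_∞·‖f‖_∞` — block decomposition, linearity of `f ↦ a•T(ι(Q″(G f)))`, V4g
✓`norm_equiv_penalty_solution_le` per block (`‖f_v‖_{L²} ≤ √(c₀(L^d)^{K−n})·‖f‖_∞`), and `Σ_v e^{−μ(tdist(B x₀, v) − 3)} ≤ e^{3μ}·(2(1 + 1∕μ))³` (✓`sum_exp_neg_mul_tdist_coarse_le`).
[cite: Balaban1985BackgroundPropagators, (3.24) p.394, Thm 3.1 (3.42) p.397] -/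
theorem norm_equiv_penalty_solution_le_of_sup
    (G : SiteL2K ℂ 3 (periodsT3 F K) c₀ W₂ →ₗ[ℂ] SiteL2K ℂ 3 (periodsT3 F K) c₀ W₂)
    (hAG : ∀ f, covLapSite F n K c₀ U₀ (G f) + (a : ℂ) • T (ι (Q'' (G f))) = f)
    {μ : ℝ} (hμ : 0 < μ) {δ₁ : ℝ} (hδ₁ : 0 ≤ δ₁)
    (hδ : 3 * ((eta F n K)⁻¹) ^ 2 * (Real.exp (μ * eta F n K) - 1) ^ 2 + a * ((25 / 8) * (c₁ * ((((F.P K).L : ℝ) ^ (F.P K).d) ^ (K - n))⁻¹ / c₀)) * (Real.exp (3 * μ) - 1) ^ 2 ≤ δ₁ ^ 2)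
    (hwin : Real.sqrt (max 2 (16 * c₀ * ((F.L : ℝ) ^ (K - n)) ^ 3 / (a * c₁))) * δ₁ ≤ 1 / 10)
    (f : SiteL2K ℂ 3 (periodsT3 F K) c₀ W₂) {Fb : ℝ} (hFb : ∀ x : Site (F.P K) 0, ‖WL2.equiv ℂ _ W₂ f (siteEquiv F K x)‖ ≤ Fb) (x₀ : Site (F.P K) 0) :
    ‖WL2.equiv ℂ _ W₂ ((a : ℂ) • T (ι (Q'' (G f)))) (siteEquiv F K x₀)‖
      ≤ a * ((5 / 4) * Real.sqrt (2 * c₁) * ((((F.P K).L : ℝ) ^ (F.P K).d) ^ (K - n))⁻¹ / c₀) *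
          Real.sqrt ((25 / 8) * (c₁ * ((((F.P K).L : ℝ) ^ (F.P K).d) ^ (K - n))⁻¹ / c₀)) *
          (Real.exp (3 * μ) * (8 * Real.sqrt (max 2 (16 * c₀ * ((F.L : ℝ) ^ (K - n)) ^ 3 / (a * c₁))) ^ 2) * (Real.sqrt (c₀ * ((((F.P K).L : ℝ) ^ (F.P K).d) ^ (K - n))) * Fb)) * (2 * (1 + 1 / μ)) ^ 3 := by
  classical
  have hc₀ : 0 < c₀ := Fact.out
  have hc₁ : 0 < c₁ := Fact.out
  have hFb0 : 0 ≤ Fb := (norm_nonneg _).trans (hFb x₀)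
  set S : ℝ := Real.sqrt (c₀ * ((((F.P K).L : ℝ) ^ (F.P K).d) ^ (K - n))) * Fb with hS
  have hS0 : 0 ≤ S := by positivity
  have hP0 : 0 ≤ a * ((5 / 4) * Real.sqrt (2 * c₁) * ((((F.P K).L : ℝ) ^ (F.P K).d) ^ (K - n))⁻¹ / c₀) *
          Real.sqrt ((25 / 8) * (c₁ * ((((F.P K).L : ℝ) ^ (F.P K).d) ^ (K - n))⁻¹ / c₀)) := by positivity
  -- the penalty map is linear
  set Lp : SiteL2K ℂ 3 (periodsT3 F K) c₀ W₂ →ₗ[ℂ] SiteL2K ℂ 3 (periodsT3 F K) c₀ W₂ := (a : ℂ) • (T ∘ₗ ι ∘ₗ Q'' ∘ₗ G) with hLp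
  have hLp_apply : ∀ u, Lp u = (a : ℂ) • T (ι (Q'' (G u))) := fun u => rfl
  set g : Site (F.P K) (K - n) → SiteL2K ℂ 3 (periodsT3 F K) c₀ W₂ :=
    fun v => toL2S F K c₀ (fun x => if iterBlockOf (K - n) x = v then (toL2S F K c₀).symm f x else 0) with hg
  have hsum : ∑ v, g v = f := sum_blockCut_eq F f
  have hPsum : WL2.equiv ℂ _ W₂ ((a : ℂ) • T (ι (Q'' (G f)))) (siteEquiv F K x₀) = ∑ v, WL2.equiv ℂ _ W₂ ((a : ℂ) • T (ι (Q'' (G (g v))))) (siteEquiv F K x₀) := by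
    have e := congrFun (map_sum (WL2.linearEquiv ℂ ℂ (fun _ : TSite 3 (periodsT3 F K) => c₀) (V := W₂)) (fun v => Lp (g v)) Finset.univ) (siteEquiv F K x₀)
    simp only [WL2.linearEquiv_apply, Finset.sum_apply] at e
    rw [← map_sum, hsum] at e
    simpa only [hLp_apply] using e
  -- each block's contribution (V4g (D-P))
  have hterm : ∀ v, ‖WL2.equiv ℂ _ W₂ ((a : ℂ) • T (ι (Q'' (G (g v))))) (siteEquiv F K x₀)‖
      ≤ a * ((5 / 4) * Real.sqrt (2 * c₁) * ((((F.P K).L : ℝ) ^ (F.P K).d) ^ (K - n))⁻¹ / c₀) *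
          Real.sqrt ((25 / 8) * (c₁ * ((((F.P K).L : ℝ) ^ (F.P K).d) ^ (K - n))⁻¹ / c₀)) * (Real.exp (3 * μ) * (8 * Real.sqrt (max 2 (16 * c₀ * ((F.L : ℝ) ^ (K - n)) ^ 3 / (a * c₁))) ^ 2) * S)
          * Real.exp (-(μ * (Site.tdist (iterBlockOf (K - n) x₀) v : ℝ))) := by
    intro v
    have hV := norm_equiv_penalty_solution_le F h hε₀ hε7 U₀ hreg Q'' hseq ι hι T hT ha G hAG hμ.le hδ₁ hδ hwin (g v) v
      (blockCut_apply_eq_zero F f v) x₀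
    have hnv : ‖g v‖ ≤ S := norm_blockCut_le F f hFb v
    have he : Real.exp (-(μ * ((Site.tdist (iterBlockOf (K - n) x₀) v : ℝ) - 3)))
        = Real.exp (3 * μ) * Real.exp (-(μ * (Site.tdist (iterBlockOf (K - n) x₀) v : ℝ))) := by
      rw [← Real.exp_add]; congr 1; ring
    have hM0 : 0 ≤ (8 * Real.sqrt (max 2 (16 * c₀ * ((F.L : ℝ) ^ (K - n)) ^ 3 / (a * c₁))) ^ 2) := by positivity
    calc _ ≤ _ := hV
      _ = a * ((5 / 4) * Real.sqrt (2 * c₁) * ((((F.P K).L : ℝ) ^ (F.P K).d) ^ (K - n))⁻¹ / c₀) *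
          Real.sqrt ((25 / 8) * (c₁ * ((((F.P K).L : ℝ) ^ (F.P K).d) ^ (K - n))⁻¹ / c₀)) * (Real.exp (3 * μ) * (8 * Real.sqrt (max 2 (16 * c₀ * ((F.L : ℝ) ^ (K - n)) ^ 3 / (a * c₁))) ^ 2) * ‖g v‖)
          * Real.exp (-(μ * (Site.tdist (iterBlockOf (K - n) x₀) v : ℝ))) := by rw [he]; ring
      _ ≤ _ := by gcongr
  -- the coarse sum
  have hrow : ∑ v : Site (F.P K) (K - n), Real.exp (-(μ * (Site.tdist (iterBlockOf (K - n) x₀) v : ℝ))) ≤ (2 * (1 + 1 / μ)) ^ 3 := by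
    have h' := sum_exp_neg_mul_tdist_coarse_le F (n := n) (K := K) hμ (iterBlockOf (K - n) x₀)
    refine le_of_eq_of_le (Finset.sum_congr rfl fun v _ => ?_) h'
    rw [tdist_coarse_comm F (iterBlockOf (K - n) x₀) v]
  have hC0 : 0 ≤ a * ((5 / 4) * Real.sqrt (2 * c₁) * ((((F.P K).L : ℝ) ^ (F.P K).d) ^ (K - n))⁻¹ / c₀) *
          Real.sqrt ((25 / 8) * (c₁ * ((((F.P K).L : ℝ) ^ (F.P K).d) ^ (K - n))⁻¹ / c₀)) * (Real.exp (3 * μ) * (8 * Real.sqrt (max 2 (16 * c₀ * ((F.L : ℝ) ^ (K - n)) ^ 3 / (a * c₁))) ^ 2) * S) := by positivity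
  calc ‖WL2.equiv ℂ _ W₂ ((a : ℂ) • T (ι (Q'' (G f)))) (siteEquiv F K x₀)‖
      = ‖∑ v, WL2.equiv ℂ _ W₂ ((a : ℂ) • T (ι (Q'' (G (g v))))) (siteEquiv F K x₀)‖ := by rw [hPsum]
    _ ≤ ∑ v, ‖WL2.equiv ℂ _ W₂ ((a : ℂ) • T (ι (Q'' (G (g v))))) (siteEquiv F K x₀)‖ := norm_sum_le _ _
    _ ≤ ∑ v, a * ((5 / 4) * Real.sqrt (2 * c₁) * ((((F.P K).L : ℝ) ^ (F.P K).d) ^ (K - n))⁻¹ / c₀) *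
          Real.sqrt ((25 / 8) * (c₁ * ((((F.P K).L : ℝ) ^ (F.P K).d) ^ (K - n))⁻¹ / c₀)) * (Real.exp (3 * μ) * (8 * Real.sqrt (max 2 (16 * c₀ * ((F.L : ℝ) ^ (K - n)) ^ 3 / (a * c₁))) ^ 2) * S)
          * Real.exp (-(μ * (Site.tdist (iterBlockOf (K - n) x₀) v : ℝ))) := Finset.sum_le_sum fun v _ => hterm v
    _ = a * ((5 / 4) * Real.sqrt (2 * c₁) * ((((F.P K).L : ℝ) ^ (F.P K).d) ^ (K - n))⁻¹ / c₀) *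
          Real.sqrt ((25 / 8) * (c₁ * ((((F.P K).L : ℝ) ^ (F.P K).d) ^ (K - n))⁻¹ / c₀)) * (Real.exp (3 * μ) * (8 * Real.sqrt (max 2 (16 * c₀ * ((F.L : ℝ) ^ (K - n)) ^ 3 / (a * c₁))) ^ 2) * S)
          * ∑ v, Real.exp (-(μ * (Site.tdist (iterBlockOf (K - n) x₀) v : ℝ))) := by rw [Finset.mul_sum]
    _ ≤ a * ((5 / 4) * Real.sqrt (2 * c₁) * ((((F.P K).L : ℝ) ^ (F.P K).d) ^ (K - n))⁻¹ / c₀) *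
          Real.sqrt ((25 / 8) * (c₁ * ((((F.P K).L : ℝ) ^ (F.P K).d) ^ (K - n))⁻¹ / c₀)) * (Real.exp (3 * μ) * (8 * Real.sqrt (max 2 (16 * c₀ * ((F.L : ℝ) ^ (K - n)) ^ 3 / (a * c₁))) ^ 2) * S) * (2 * (1 + 1 / μ)) ^ 3 := mul_le_mul_of_nonneg_left hrow hC0
/-! ## §5 T1 closed -/

include hε₀ hε7 hreg hseq hι hT ha in
/-- ★★★ **T1 CLOSED — `‖D_{U₀}(G_a f)‖_∞ ≤ R₁(‖f‖_∞)` ON A GENERAL BOUNDED SOURCE, K-FREE AT THE PINS**: under V4g's letters, `hroom` and `hsmall`, for every `f` with `‖f(x)‖ ≤ F_b` and every bond `p`,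
`‖(D_{U₀}(G_a f))(p)‖ ≤ 2·(C_g·(M_u·c(ε₀) + (M_p + F_b)) + 2√2·48ε₀·M_u)`, `M_u`∕`M_p` := §2∕§3's bounds — px19's T1-core ✓`norm_equiv_DL2_le_of_sup` at `(G f, a•TιQ″(Gf) − f)`. [cite: Balaban1985BackgroundPropagators, Thm 3.1 (3.42)–(3.47) pp.397–398, (3.139) p.425] -/
theorem norm_equiv_DL2_massiveSolution_le
    (G : SiteL2K ℂ 3 (periodsT3 F K) c₀ W₂ →ₗ[ℂ] SiteL2K ℂ 3 (periodsT3 F K) c₀ W₂)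
    (hAG : ∀ f, covLapSite F n K c₀ U₀ (G f) + (a : ℂ) • T (ι (Q'' (G f))) = f)
    {μ : ℝ} (hμ : 0 < μ) {δ₁ : ℝ} (hδ₁ : 0 ≤ δ₁)
    (hδ : 3 * ((eta F n K)⁻¹) ^ 2 * (Real.exp (μ * eta F n K) - 1) ^ 2 + a * ((25 / 8) * (c₁ * ((((F.P K).L : ℝ) ^ (F.P K).d) ^ (K - n))⁻¹ / c₀)) * (Real.exp (3 * μ) - 1) ^ 2 ≤ δ₁ ^ 2)
    (hwin : Real.sqrt (max 2 (16 * c₀ * ((F.L : ℝ) ^ (K - n)) ^ 3 / (a * c₁))) * δ₁ ≤ 1 / 10)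
    (hroom : 2 * (12 * F.L ^ (K - n) + 5) ≤ (F.P K).sitesPerDir 0)
    (hsmall : exists_curved_localGradient.choose * ((48 * ε₀) * (6 * Real.sqrt 2 * Real.sqrt 10 + 6 * Real.sqrt 2)) ≤ 1 / 2)
    (f : SiteL2K ℂ 3 (periodsT3 F K) c₀ W₂) {Fb : ℝ} (hFb : ∀ x : Site (F.P K) 0, ‖WL2.equiv ℂ _ W₂ f (siteEquiv F K x)‖ ≤ Fb) :
    ∀ p : Bond 3 (periodsT3 F K), ‖WL2.equiv ℂ (fun _ : Bond 3 (periodsT3 F K) => c₀) W₂ (DL2 F n K c₀ U₀ (G f)) p‖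
      ≤ 2 * (exists_curved_localGradient.choose *
            ((((14 * (8 * Real.exp (3 * min μ (1 / 4)) * (Fb + Real.exp (3 * μ) * ((a * ((5 / 4) * Real.sqrt (2 * c₁) * ((((F.P K).L : ℝ) ^ (F.P K).d) ^ (K - n))⁻¹ / c₀) * Real.sqrt ((25 / 8) * (c₁ * ((((F.P K).L : ℝ) ^ (F.P K).d) ^ (K - n))⁻¹ / c₀))) * ((8 * Real.sqrt (max 2 (16 * c₀ * ((F.L : ℝ) ^ (K - n)) ^ 3 / (a * c₁))) ^ 2) * (Real.sqrt (c₀ * ((((F.P K).L : ℝ) ^ (F.P K).d) ^ (K - n))) * Fb))))))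
          + (Real.sqrt (3 ^ 3 / (c₀ * ((F.L : ℝ) ^ (K - n)) ^ 3) * 8) * (Real.sqrt (8 * Real.exp (3 * min μ (1 / 4)) * Real.exp (6 * μ) * (2 * (1 + 1 / μ)) ^ 3) * ((8 * Real.sqrt (max 2 (16 * c₀ * ((F.L : ℝ) ^ (K - n)) ^ 3 / (a * c₁))) ^ 2) * (Real.sqrt (c₀ * ((((F.P K).L : ℝ) ^ (F.P K).d) ^ (K - n))) * Fb)))))
        * (2 * (1 + 1 / (min μ (1 / 4) / 2))) ^ 3) * (2 + 2 * Real.sqrt 2 * (4 * ε₀ * (3 + 2457 * norm_bgOfCfg_axialT_sub_le.choose)) + (24 * Real.sqrt 10 + 48) * (48 * ε₀) ^ 2)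
              + ((a * ((5 / 4) * Real.sqrt (2 * c₁) * ((((F.P K).L : ℝ) ^ (F.P K).d) ^ (K - n))⁻¹ / c₀) *
          Real.sqrt ((25 / 8) * (c₁ * ((((F.P K).L : ℝ) ^ (F.P K).d) ^ (K - n))⁻¹ / c₀)) *
          (Real.exp (3 * μ) * (8 * Real.sqrt (max 2 (16 * c₀ * ((F.L : ℝ) ^ (K - n)) ^ 3 / (a * c₁))) ^ 2) * (Real.sqrt (c₀ * ((((F.P K).L : ℝ) ^ (F.P K).d) ^ (K - n))) * Fb)) * (2 * (1 + 1 / μ)) ^ 3) + Fb))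
          + 2 * Real.sqrt 2 * (48 * ε₀) * (((14 * (8 * Real.exp (3 * min μ (1 / 4)) * (Fb + Real.exp (3 * μ) * ((a * ((5 / 4) * Real.sqrt (2 * c₁) * ((((F.P K).L : ℝ) ^ (F.P K).d) ^ (K - n))⁻¹ / c₀) * Real.sqrt ((25 / 8) * (c₁ * ((((F.P K).L : ℝ) ^ (F.P K).d) ^ (K - n))⁻¹ / c₀))) * ((8 * Real.sqrt (max 2 (16 * c₀ * ((F.L : ℝ) ^ (K - n)) ^ 3 / (a * c₁))) ^ 2) * (Real.sqrt (c₀ * ((((F.P K).L : ℝ) ^ (F.P K).d) ^ (K - n))) * Fb))))))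
          + (Real.sqrt (3 ^ 3 / (c₀ * ((F.L : ℝ) ^ (K - n)) ^ 3) * 8) * (Real.sqrt (8 * Real.exp (3 * min μ (1 / 4)) * Real.exp (6 * μ) * (2 * (1 + 1 / μ)) ^ 3) * ((8 * Real.sqrt (max 2 (16 * c₀ * ((F.L : ℝ) ^ (K - n)) ^ 3 / (a * c₁))) ^ 2) * (Real.sqrt (c₀ * ((((F.P K).L : ℝ) ^ (F.P K).d) ^ (K - n))) * Fb)))))
        * (2 * (1 + 1 / (min μ (1 / 4) / 2))) ^ 3)) := by
  -- sups at lit-balaban's sites from sups at the route's sites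
  have hsite : ∀ (P : TSite 3 (periodsT3 F K) → Prop), (∀ x : Site (F.P K) 0, P (siteEquiv F K x)) → ∀ z, P z := by
    intro P hP z
    have := hP ((siteEquiv F K).symm z)
    rwa [Equiv.apply_symm_apply] at this
  have hL1 : (1 : ℝ) ≤ (F.L : ℝ) := by have := F.hL.2; exact_mod_cast this.le
  have hε1 : ε₀ ≤ 1 := by
    have h1 : (1 : ℝ) ≤ 10 ^ 7 * (F.L : ℝ) ^ 3 := by
      have : (1 : ℝ) ≤ (F.L : ℝ) ^ 3 := one_le_pow₀ hL1
      nlinarith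
    nlinarith
  have hc₀ : 0 < c₀ := Fact.out
  have hc₁ : 0 < c₁ := Fact.out
  have hFb0 : 0 ≤ Fb := (norm_nonneg _).trans (hFb default)
  have hCg0 : 0 ≤ exists_curved_localGradient.choose := exists_curved_localGradient.choose_spec.1
  -- the massive equation as `Δ^η_{U₀}(G f) + q = D*_{U₀} 0`, `q := a•T(ι(Q″(G f))) − f`; then T1-core (px19 g13) with the sups of §2, §3
  have hueq : covLapSite F n K c₀ U₀ (G f) + ((a : ℂ) • T (ι (Q'' (G f))) - f) = DstarL2 F n K c₀ U₀ 0 := by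
    rw [← add_sub_assoc, hAG f, sub_self, map_zero]
  refine norm_equiv_DL2_le_of_sup F n K hε₀ hε1 U₀ hreg c₀ (G f) _ hueq ?_ ?_
    (hsite _ fun x => norm_equiv_massiveSolution_apply_le_of_sup F h hε₀ hε7 U₀ hreg Q'' hseq ι hι T hT ha G hAG hμ hδ₁ hδ hwin f hFb x)
    (fun z => ?_) hroom hsmall
  · positivity
  · positivity
  · rw [WL2.equiv_sub, Pi.sub_apply]
    exact (norm_sub_le _ _).trans (add_le_add
      (hsite (fun z => ‖WL2.equiv ℂ (fun _ : TSite 3 (periodsT3 F K) => c₀) W₂ ((a : ℂ) • T (ι (Q'' (G f)))) z‖ ≤ _)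
        (fun x => norm_equiv_penalty_solution_le_of_sup F h hε₀ hε7 U₀ hreg Q'' hseq ι hι T hT ha G hAG hμ hδ₁ hδ hwin f hFb x) z)
      (hsite (fun z => ‖WL2.equiv ℂ (fun _ : TSite 3 (periodsT3 F K) => c₀) W₂ f z‖ ≤ Fb) hFb z))
/-! ## §6 The two letters in the `ℓ^∞ → ℓ^∞` operator shape of the hPcol knit (P4's `hGsup`∕`hT1`, `Fb` factored out) -/

include hε₀ hε7 hreg hseq hι hT ha in
/-- ★★★ **`‖G_a‖_{∞→∞} ≤ B_∞`** — §2 over lit-balaban's sites with `F_b` factored (`ring`): the `hGsup` letter of px5 g13's P4 knit `…PcolOfGradientRow` VERBATIM, `B_∞` explicit, K-free at the pin. [cite: Balaban1985BackgroundPropagators, Thm 3.1 (3.42) p.397] -/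
theorem hGsup_of_regPr
    (G : SiteL2K ℂ 3 (periodsT3 F K) c₀ W₂ →ₗ[ℂ] SiteL2K ℂ 3 (periodsT3 F K) c₀ W₂)
    (hAG : ∀ f, covLapSite F n K c₀ U₀ (G f) + (a : ℂ) • T (ι (Q'' (G f))) = f)
    {μ : ℝ} (hμ : 0 < μ) {δ₁ : ℝ} (hδ₁ : 0 ≤ δ₁)
    (hδ : 3 * ((eta F n K)⁻¹) ^ 2 * (Real.exp (μ * eta F n K) - 1) ^ 2 + a * ((25 / 8) * (c₁ * ((((F.P K).L : ℝ) ^ (F.P K).d) ^ (K - n))⁻¹ / c₀)) * (Real.exp (3 * μ) - 1) ^ 2 ≤ δ₁ ^ 2)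
    (hwin : Real.sqrt (max 2 (16 * c₀ * ((F.L : ℝ) ^ (K - n)) ^ 3 / (a * c₁))) * δ₁ ≤ 1 / 10) :
    ∀ (f : SiteL2K ℂ 3 (periodsT3 F K) c₀ W₂) (Fb : ℝ), (∀ y, ‖WL2.equiv ℂ _ W₂ f y‖ ≤ Fb) →
      ∀ y, ‖WL2.equiv ℂ _ W₂ (G f) y‖
        ≤ (((14 * (8 * Real.exp (3 * min μ (1 / 4)) * (1 + Real.exp (3 * μ) * ((a * ((5 / 4) * Real.sqrt (2 * c₁) * ((((F.P K).L : ℝ) ^ (F.P K).d) ^ (K - n))⁻¹ / c₀) * Real.sqrt ((25 / 8) * (c₁ * ((((F.P K).L : ℝ) ^ (F.P K).d) ^ (K - n))⁻¹ / c₀))) * ((8 * Real.sqrt (max 2 (16 * c₀ * ((F.L : ℝ) ^ (K - n)) ^ 3 / (a * c₁))) ^ 2) * (Real.sqrt (c₀ * ((((F.P K).L : ℝ) ^ (F.P K).d) ^ (K - n))) * 1))))))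
          + (Real.sqrt (3 ^ 3 / (c₀ * ((F.L : ℝ) ^ (K - n)) ^ 3) * 8) * (Real.sqrt (8 * Real.exp (3 * min μ (1 / 4)) * Real.exp (6 * μ) * (2 * (1 + 1 / μ)) ^ 3) * ((8 * Real.sqrt (max 2 (16 * c₀ * ((F.L : ℝ) ^ (K - n)) ^ 3 / (a * c₁))) ^ 2) * (Real.sqrt (c₀ * ((((F.P K).L : ℝ) ^ (F.P K).d) ^ (K - n))) * 1)))))
        * (2 * (1 + 1 / (min μ (1 / 4) / 2))) ^ 3) * Fb := by
  intro f Fb hf y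
  obtain ⟨x₀, rfl⟩ := (siteEquiv F K).surjective y
  refine (norm_equiv_massiveSolution_apply_le_of_sup F h hε₀ hε7 U₀ hreg Q'' hseq ι hι T hT ha G hAG hμ hδ₁ hδ hwin f (fun x => hf _) x₀).trans (le_of_eq ?_)
  ring

include hε₀ hε7 hreg hseq hι hT ha in
/-- ★★★ **`‖D_{U₀} G_a‖_{∞→∞} ≤ R₁` — T1 IN THE KNIT's LETTER SHAPE**: §5 with `F_b` factored (`ring`): the `hT1` letter of px5 g13's P4 knit VERBATIM, `R₁` explicit. [cite: Balaban1985BackgroundPropagators, Thm 3.1 (3.42)–(3.44) pp.397–398, (3.139) p.425] -/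
theorem hT1_of_regPr
    (G : SiteL2K ℂ 3 (periodsT3 F K) c₀ W₂ →ₗ[ℂ] SiteL2K ℂ 3 (periodsT3 F K) c₀ W₂)
    (hAG : ∀ f, covLapSite F n K c₀ U₀ (G f) + (a : ℂ) • T (ι (Q'' (G f))) = f)
    {μ : ℝ} (hμ : 0 < μ) {δ₁ : ℝ} (hδ₁ : 0 ≤ δ₁)
    (hδ : 3 * ((eta F n K)⁻¹) ^ 2 * (Real.exp (μ * eta F n K) - 1) ^ 2 + a * ((25 / 8) * (c₁ * ((((F.P K).L : ℝ) ^ (F.P K).d) ^ (K - n))⁻¹ / c₀)) * (Real.exp (3 * μ) - 1) ^ 2 ≤ δ₁ ^ 2)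
    (hwin : Real.sqrt (max 2 (16 * c₀ * ((F.L : ℝ) ^ (K - n)) ^ 3 / (a * c₁))) * δ₁ ≤ 1 / 10)
    (hroom : 2 * (12 * F.L ^ (K - n) + 5) ≤ (F.P K).sitesPerDir 0)
    (hsmall : exists_curved_localGradient.choose * ((48 * ε₀) * (6 * Real.sqrt 2 * Real.sqrt 10 + 6 * Real.sqrt 2)) ≤ 1 / 2) :
    ∀ (f : SiteL2K ℂ 3 (periodsT3 F K) c₀ W₂) (Fb : ℝ), (∀ y, ‖WL2.equiv ℂ _ W₂ f y‖ ≤ Fb) →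
      ∀ p : Bond 3 (periodsT3 F K), ‖WL2.equiv ℂ _ W₂ (DL2 F n K c₀ U₀ (G f)) p‖
        ≤ (2 * (exists_curved_localGradient.choose *
            ((((14 * (8 * Real.exp (3 * min μ (1 / 4)) * (1 + Real.exp (3 * μ) * ((a * ((5 / 4) * Real.sqrt (2 * c₁) * ((((F.P K).L : ℝ) ^ (F.P K).d) ^ (K - n))⁻¹ / c₀) * Real.sqrt ((25 / 8) * (c₁ * ((((F.P K).L : ℝ) ^ (F.P K).d) ^ (K - n))⁻¹ / c₀))) * ((8 * Real.sqrt (max 2 (16 * c₀ * ((F.L : ℝ) ^ (K - n)) ^ 3 / (a * c₁))) ^ 2) * (Real.sqrt (c₀ * ((((F.P K).L : ℝ) ^ (F.P K).d) ^ (K - n))) * 1))))))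
          + (Real.sqrt (3 ^ 3 / (c₀ * ((F.L : ℝ) ^ (K - n)) ^ 3) * 8) * (Real.sqrt (8 * Real.exp (3 * min μ (1 / 4)) * Real.exp (6 * μ) * (2 * (1 + 1 / μ)) ^ 3) * ((8 * Real.sqrt (max 2 (16 * c₀ * ((F.L : ℝ) ^ (K - n)) ^ 3 / (a * c₁))) ^ 2) * (Real.sqrt (c₀ * ((((F.P K).L : ℝ) ^ (F.P K).d) ^ (K - n))) * 1)))))
        * (2 * (1 + 1 / (min μ (1 / 4) / 2))) ^ 3) * (2 + 2 * Real.sqrt 2 * (4 * ε₀ * (3 + 2457 * norm_bgOfCfg_axialT_sub_le.choose)) + (24 * Real.sqrt 10 + 48) * (48 * ε₀) ^ 2)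
              + ((a * ((5 / 4) * Real.sqrt (2 * c₁) * ((((F.P K).L : ℝ) ^ (F.P K).d) ^ (K - n))⁻¹ / c₀) *
          Real.sqrt ((25 / 8) * (c₁ * ((((F.P K).L : ℝ) ^ (F.P K).d) ^ (K - n))⁻¹ / c₀)) *
          (Real.exp (3 * μ) * (8 * Real.sqrt (max 2 (16 * c₀ * ((F.L : ℝ) ^ (K - n)) ^ 3 / (a * c₁))) ^ 2) * (Real.sqrt (c₀ * ((((F.P K).L : ℝ) ^ (F.P K).d) ^ (K - n))) * 1)) * (2 * (1 + 1 / μ)) ^ 3) + 1))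
          + 2 * Real.sqrt 2 * (48 * ε₀) * (((14 * (8 * Real.exp (3 * min μ (1 / 4)) * (1 + Real.exp (3 * μ) * ((a * ((5 / 4) * Real.sqrt (2 * c₁) * ((((F.P K).L : ℝ) ^ (F.P K).d) ^ (K - n))⁻¹ / c₀) * Real.sqrt ((25 / 8) * (c₁ * ((((F.P K).L : ℝ) ^ (F.P K).d) ^ (K - n))⁻¹ / c₀))) * ((8 * Real.sqrt (max 2 (16 * c₀ * ((F.L : ℝ) ^ (K - n)) ^ 3 / (a * c₁))) ^ 2) * (Real.sqrt (c₀ * ((((F.P K).L : ℝ) ^ (F.P K).d) ^ (K - n))) * 1))))))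
          + (Real.sqrt (3 ^ 3 / (c₀ * ((F.L : ℝ) ^ (K - n)) ^ 3) * 8) * (Real.sqrt (8 * Real.exp (3 * min μ (1 / 4)) * Real.exp (6 * μ) * (2 * (1 + 1 / μ)) ^ 3) * ((8 * Real.sqrt (max 2 (16 * c₀ * ((F.L : ℝ) ^ (K - n)) ^ 3 / (a * c₁))) ^ 2) * (Real.sqrt (c₀ * ((((F.P K).L : ℝ) ^ (F.P K).d) ^ (K - n))) * 1)))))
        * (2 * (1 + 1 / (min μ (1 / 4) / 2))) ^ 3))) * Fb := by
  intro f Fb hf p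
  refine (norm_equiv_DL2_massiveSolution_le F h hε₀ hε7 U₀ hreg Q'' hseq ι hι T hT ha G hAG hμ hδ₁ hδ hwin hroom hsmall f (fun x => hf _) p).trans (le_of_eq ?_)
  ring

end Summit.QuantumFields.YangMills.Theorems.Prop7MassiveSolutionGradientSupOfRegPr

end
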